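import Summits.ValiantsHypothesis.ValiantsHypothesis.Theorems.BarrierLeverAnchoredDoorHitsLowerPairsSRStub
import Summits.ValiantsHypothesis.ValiantsHypothesis.Theorems.BarrierLeverAnchoredDoorHitsLowerPairsRoutingStub
import Mathlib.Data.Fin.Tuple.Sort

/-!
# Support item `AnchoredDoorHitsLowerPairs` (stmt-ValiantsHypothesis-22510), line `anchored-peeling`:
# a ROUTING is SPLIT-ROUTING DATA — `Stmt.stub_routing → Stmt.stub_sr`

Helper file (`--supports stmt-ValiantsHypothesis-22510`; cell valiant-natproofs, rung V4, 𝒟-side door (c); registered line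
`Cruxes/AnchoredDoorHitsLowerPairs/Lines/anchored_peeling.lean` v12; prover seat val-np-p1 gen 19). Definition-free. Closes NO item.

The registry merger of skeleton v12 (planner p1 g20, 2026-08-28T05:04Z) replaced `stub_routing` (p595918) by `stub_sr` (p605298) «modulo the routine
lemma HasRouting u w → 2 ≤ r → SRData u w». This file supplies it.

* `DTPeel.srData_of_hasRouting` — a routing (valid `x`-side schedule with `runU = ∅` and `runE = w ∘ π`) of an injective column family with `r ≥ 2`
  is split-routing data: take ALL `r` columns as the shift blocks, enumerated by NON-INCREASING cardinality (`Tuple.sort` on `ℕᵒᵈ`); then the first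
  listed shift contained in the column `w k` is `w k` itself (an earlier shift inside `w k` has at least the same cardinality, hence equals it), every
  block has exactly one row and one key column (size condition `1 = 1`), and `1 < r` is the non-triviality.
* `stub_sr_of_routing : Stmt.stub_routing → Stmt.stub_sr` — so every routing certificate (kernel `decide` instances of p595531, census routers) counts
  toward the registered stub `stub_sr`, as the skeleton's v12 comment anticipates.

WHAT THIS IS NOT: no claim that either conjecture holds; nothing on crux stmt-ValiantsHypothesis-14610 or on `VP` versus `VNP`.
-/

set_option linter.dupNamespace false

namespace Summit.ValiantsHypothesis.ValiantsHypothesis.Theorems.BarrierLever.AnchoredPeeling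

open Finset

noncomputable section

namespace DTPeel

variable {h r : ℕ}

/-- **A routing is split-routing data** (`r ≥ 2`, columns injective): shifts = all columns sorted by non-increasing cardinality, one row and one
key column per block. -/
theorem srData_of_hasRouting (u w : Fin r → Finset (Fin h)) (hw : Function.Injective w) (hr : 2 ≤ r)
    (H : HasRouting u w) : SRData u w := by
  classical
  obtain ⟨L, π, hv, hU, hE⟩ := H
  -- sort the columns by non-increasing cardinality
  let f : Fin r → ℕᵒᵈ := fun k => OrderDual.toDual (w k).card
  let σ : Equiv.Perm (Fin r) := Tuple.sort f
  have hmono : Monotone (f ∘ σ) := Tuple.monotone_sort f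
  have hanti : ∀ {j' j : Fin r}, j' ≤ j → (w (σ j)).card ≤ (w (σ j')).card := fun {j' j} hle => by
    have := hmono hle
    exact OrderDual.toDual_le_toDual.mp this
  -- an earlier (or equal-index) shift contained in a later one is equal to it
  have hkey : ∀ {j' j : Fin r}, j' ≤ j → w (σ j') ⊆ w (σ j) → j' = j := fun {j' j} hle hsub => by
    have heq : w (σ j') = w (σ j) := Finset.eq_of_subset_of_card_le hsub (hanti hle)
    exact σ.injective (hw heq)
  refine ⟨L, r, fun j => w (σ j), fun i => σ.symm (π i), hv, hw.comp σ.injective, ?_, ?_, ?_, ?_⟩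
  · -- final rows are pairwise distinct (their shifts already are)
    intro i i' _ hEi
    rw [hE i, hE i'] at hEi
    exact π.injective (hw hEi)
  · intro i
    show runE L u (fun _ => ∅) i = w (σ (σ.symm (π i)))
    rw [Equiv.apply_symm_apply, hE i]
  · -- size condition: both sides are singletons
    intro j
    have hl : (univ.filter fun i => σ.symm (π i) = j) = {π.symm (σ j)} := by
      ext i
      simp only [Finset.mem_filter, Finset.mem_univ, true_and, Finset.mem_singleton]
      constructor
      · intro hi
        have : π i = σ j := by rw [← hi, Equiv.apply_symm_apply]
        rw [← this, Equiv.symm_apply_apply]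
      · rintro rfl
        rw [Equiv.apply_symm_apply, Equiv.symm_apply_apply]
    have hr' : (univ.filter fun k => w (σ j) ⊆ w k ∧ ∀ j', j' < j → ¬ w (σ j') ⊆ w k) = {σ j} := by
      ext k
      simp only [Finset.mem_filter, Finset.mem_univ, true_and, Finset.mem_singleton]
      constructor
      · rintro ⟨hsub, hfirst⟩
        -- write k = σ j''
        obtain ⟨j'', rfl⟩ : ∃ j'', σ j'' = k := ⟨σ.symm k, Equiv.apply_symm_apply σ k⟩
        rcases lt_trichotomy j'' j with hlt | heq | hgt
        · exact absurd subset_rfl (hfirst j'' hlt)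
        · rw [heq]
        · exact absurd (hkey (le_of_lt hgt) hsub) (ne_of_lt hgt)
      · rintro rfl
        exact ⟨subset_rfl, fun j' hj' hsub => absurd (hkey (le_of_lt hj') hsub) (ne_of_lt hj')⟩
    rw [hl, hr', Finset.card_singleton, Finset.card_singleton]
  · -- non-triviality: each block has one row, and `1 < r`
    intro j
    have hl : (univ.filter fun i => σ.symm (π i) = j) = {π.symm (σ j)} := by
      ext i
      simp only [Finset.mem_filter, Finset.mem_univ, true_and, Finset.mem_singleton]
      constructor
      · intro hi
        have : π i = σ j := by rw [← hi, Equiv.apply_symm_apply]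
        rw [← this, Equiv.symm_apply_apply]
      · rintro rfl
        rw [Equiv.apply_symm_apply, Equiv.symm_apply_apply]
    rw [hl, Finset.card_singleton]
    omega

end DTPeel

/-- **The routing conjecture implies Conjecture SR** (skeleton v12 merger): a routing on either side is split-routing data on that side. -/
theorem stub_sr_of_routing (H : Stmt.stub_routing) : Stmt.stub_sr := by
  intro h r u w hu hw hlu hlw hr
  rcases H h r u w hu hw hlu hlw with H₁ | H₁
  · exact Or.inl (DTPeel.srData_of_hasRouting u w hw hr H₁)
  · exact Or.inr (DTPeel.srData_of_hasRouting w u hu hr H₁)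

/-- Hence a routing on either side of an injective lower pair with `r ≥ 2` gives split-routing data there (item-level form, no stub hypothesis). -/
theorem DTPeel.srData_or_of_hasRouting_or {h r : ℕ} (u w : Fin r → Finset (Fin h)) (hu : Function.Injective u)
    (hw : Function.Injective w) (hr : 2 ≤ r) (H : DTPeel.HasRouting u w ∨ DTPeel.HasRouting w u) :
    DTPeel.SRData u w ∨ DTPeel.SRData w u := by
  rcases H with H₁ | H₁
  · exact Or.inl (DTPeel.srData_of_hasRouting u w hw hr H₁)
  · exact Or.inr (DTPeel.srData_of_hasRouting w u hu hr H₁)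

end

end Summit.ValiantsHypothesis.ValiantsHypothesis.Theorems.BarrierLever.AnchoredPeeling
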